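import Summits.BirchSwinnertonDyer.BirchSwinnertonDyer.Theorems.ThetaPartnerAtTwoSignedControlAtTwoPlusCyclicOfHonda
import HarnessLib

/-!
# CYC⁻ (monogenicity of Kobayashi's MINUS groups `E⁻(K_{2j+1}·K_v)` modulo `p`) from a Honda system on the `ℤ_p`-tower —
# the odd-layer twin of `SignedEC.plusCyclic_even_of_honda` (Kobayashi Prop. 8.12 i) for the sign `−`), any `K`, `p`, `κ`, `ι`;
# base layer `1` from Sprung's relation `Tr_{1/0} c_1 = a_p c_0 − (p−1) c_{−1}`

LADDER-BSD D-0154 (2) INPUTS→UNCONDITIONAL, INPUTS-LIST-2 row F10 (ADDENDUM-5 §C, tranche T2b, the `ε = −1` half), seat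
`bsd-inputs-kim315-p1` (gen 2); `--supports` stmt-BirchSwinnertonDyer-19288 (B. D. Kim 2013 Cor. 3.15 =
`BDKim2013.cor315_signedCharValue_rankZero` BY NAME). First file of the `♯`/minus port announced in
`…Theorems/SignedLowerHalvesBDKimSignedSelmerEqFlatOdd.lean`: the identity `Sel⁻(E/ℚ_∞) = Sel♯(E/ℚ_∞)` at `a_p = 0` needs
«`Ker Col♯ = Ann(⨆ₙ E⁻_n)`», whose inclusion `⊆` rests on CYC⁻ exactly as the TP2 width seat's `Ker Col♭ ⊆ Ann(E⁺_∞)`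
(`SignedKatoOffTwo.FlatKernel.apply_eq_zero_of_mem_colemanKer_flat_of_mem_plus`) rests on CYC⁺.

HONEST FRAMING: THEOREMS ONLY (no definition, no named fact, no instance, no `sorry`); local algebra of the signed point groups
for an abstract Honda system (displayed clauses); route-independent; nothing about any Selmer group or curve is asserted;
closes nothing; BSD is not proved by any of this.

## The argument (Kobayashi, Invent. Math. 152 (2003), Prop. 8.12, read for the odd Honda points)

With (L) `d_m ∈ E(K_m·K_v)`, (TR) `Tr_{m+2/m+1} d_{m+2} = −d_m`: `d_{2j+1} ∈ E⁻(K_{2j+1}·K_v)` (§2, the traces down the ODD chain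
land in the odd layers — twin of `d_even_mem_signedLocalPointsOfEmb_one`). CYC⁻ at layer `2j+1`: every `x ∈ E⁻_{2j+1}` is
`B + p·b` with `B` in the span of the `Γ_{K_v}`-orbit of `d_{2j+1}` and `b ∈ E⁻_{2j+1}` — by induction on `j` exactly as in
`plusCyclic_even_of_honda` with all indices shifted by one ((GEN) at `m = 2j+3`, the intermediate layer `2j+2` of degree `p`
(IDX), `E⁻_{2j+3} ∩ E(K_{2j+2}) ≤ E⁻_{2j+2} ≤ E⁻_{2j+1}`, saturation (NT)). The BASE is layer `1`, where `E⁻_1 = E(K_1·K_v)` (no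
odd index below `1`) and monogenicity is NOT a consequence of (TR)/(GEN)/(GEN₀) alone: it is the clause (CYC₁)
`E(K_1·K_v) = ℤ[Γ]·d_1 + p·E(K_1·K_v)`, which §4 derives from generation at `m = 1`, generation of `E(K_v)` by `c_{−1}` and
Sprung's level-one relation `Tr_{1/0} d_1 = −(p−1)·c_{−1}` (`a_p = 0`; so `c_{−1} ≡ Tr_{1/0} d_1 (mod p)`), i.e. from the primal
Honda data of Sprung's Thm. 2.2 as seat honda-p1 states it.

## What is proved (namespace `…Theorems.SignedEC`, next to the plus versions)

* §1 `signedLocalPointsOfEmb_neg_one_one` (`E⁻_1 = E(K_1·K_v)`), `signedLocalPointsOfEmb_neg_one_even_succ_le`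
  (`E⁻_{2j+2} ≤ E⁻_{2j+1}`, under (NT)).
* §2 `localTraceOfEmb_d_odd_mem`, `d_odd_mem_signedLocalPointsOfEmb_neg_one` (`d_{2j+1} ∈ E⁻_{2j+1}`).
* §3 **`minusCyclic_odd_of_honda`** — CYC⁻ at the odd layers from (NT), (IDX), (L), (TR), (GEN), (CYC₁).
* §4 `gen_zero_cneg_of_nsmul`, **`cyc_one_of_gen`** — (CYC₁) from (GEN) at `m = 1`, `E(K_v) = ℤ·c_{−1} + p·E(K_v)` (multiplier-`N`
  form allowed) and `Tr_{1/0} d_1 = −(p−1)·c_{−1}`.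

References: [Kobayashi2003] S. Kobayashi, Invent. Math. 152 (2003), Def. 1.1, Lemma 8.9, Prop. 8.12 (pp. 16–18); [Sprung2012]
F. Sprung, J. Number Theory 132 (2012), Thm. 2.2 (p. 1487), Cor. 2.10. Credit: seat tp2-p3-w3 (`plusCyclic_even_of_honda`, whose
proof is mirrored here line by line).
-/

set_option autoImplicit false
-- the Theorems namespace of this sub repeats the summit name by design (D-0017 nested layout)
set_option linter.dupNamespace false

noncomputable section

open scoped Classical

open Finset

namespace Summit.BirchSwinnertonDyer.BirchSwinnertonDyer.Theorems.SignedEC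

open Literature.NumberTheory.EllipticCurves Literature.NumberTheory.GaloisRepresentations
  WeierstrassCurve ZpExtension Literature.NumberTheory.EllipticCurves.Kobayashi2003
  Literature.NumberTheory.EllipticCurves.Sprung2012 Summit.BirchSwinnertonDyer.Rank1Residual.Additive

universe u

variable {K : Type u} [Field K] (W : WeierstrassCurve K) {p : ℕ} [Fact p.Prime] (κ : ZpExtension K p)
  {E : Type u} [Field E] [Algebra K E] (ι : AlgebraicClosure K →ₐ[K] AlgebraicClosure E)

/-! ## §1 Bookkeeping for the minus groups -/

/-- **`E⁻(K_1·K_v) = E(K_1·K_v)`**: at layer `1` the minus condition (odd indices `m < 1`) is empty.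
[cite: Kobayashi2003, Def. 1.1 (p. 2)] -/
theorem signedLocalPointsOfEmb_neg_one_one :
    signedLocalPointsOfEmb κ ι W (-1) 1 = localLayerPointsOfEmb κ ι W 1 := by
  ext P
  rw [mem_signedLocalPointsOfEmb_neg_one_iff]
  constructor
  · exact fun h ↦ h.1
  · intro h
    refine ⟨h, fun m hm hodd ↦ ?_⟩
    obtain ⟨i, hi⟩ := hodd
    omega

/-- **The even minus layers collapse onto the previous odd layer**: `E⁻(K_{2j+2}·K_v) ≤ E⁻(K_{2j+1}·K_v)` (the condition at the odd
index `2j+1` says `P ∈ E(K_{2j+1}·K_v)`; then layer descent of the signed condition, (NT)). Twin of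
`signedLocalPointsOfEmb_one_odd_le`. [cite: Kobayashi2003, Def. 1.1 and proof of Prop. 8.12 (p. 18)] -/
theorem signedLocalPointsOfEmb_neg_one_even_succ_le
    (hnt : ∀ P ∈ localTowerPointsOfEmb κ ι W, p • P = 0 → P = 0) (j : ℕ) :
    signedLocalPointsOfEmb κ ι W (-1) (2 * j + 2) ≤ signedLocalPointsOfEmb κ ι W (-1) (2 * j + 1) := by
  intro P hP
  have hP' := hP
  rw [mem_signedLocalPointsOfEmb_neg_one_iff] at hP'
  have h := hP'.2 (2 * j + 1) (by omega) ⟨j, rfl⟩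
  rw [show 2 * j + 1 + 1 = 2 * j + 2 by ring, localTraceOfEmb_self_of_mem κ ι W (2 * j + 2) hP'.1] at h
  exact mem_signedLocalPointsOfEmb_of_mem_layer W κ ι hnt (-1) (by omega) hP h

/-! ## §2 The odd Honda points satisfy the minus conditions -/

/-- For `d` with (L) and (TR): `Tr_{2j+1/2i+2} d_{2j+1} ∈ E(K_{2i+1}·K_v)` for `i < j` (trace transitivity down the ODD chain).
Twin of `localTraceOfEmb_d_even_mem`. [cite: Kobayashi2003, Lemma 8.9, Prop. 8.12 i)] -/
theorem localTraceOfEmb_d_odd_mem (d : ℕ → localPoints W E) (hd : ∀ m, d m ∈ localLayerPointsOfEmb κ ι W m)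
    (htr : ∀ m, localTraceOfEmb κ ι W (m + 1) (m + 2) (d (m + 2)) = -d m) :
    ∀ j i : ℕ, i < j →
      localTraceOfEmb κ ι W (2 * i + 2) (2 * j + 1) (d (2 * j + 1)) ∈ localLayerPointsOfEmb κ ι W (2 * i + 1) := by
  intro j
  induction j with
  | zero => intro i hi; omega
  | succ j ih =>
    intro i hi
    rcases Nat.lt_succ_iff_lt_or_eq.1 hi with hlt | rfl
    · -- `i < j`: go through the layer `2j+2`
      have hd2 : d (2 * j + 3) ∈ localFixedPointsOfEmb ι W (κ.layerSubgroup (2 * j + 3)) := hd (2 * j + 3)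
      have htr' : localPairTraceOfEmb ι W (κ.layerSubgroup (2 * j + 2)) (κ.layerSubgroup (2 * j + 3))
          (d (2 * j + 3)) = -d (2 * j + 1) := by
        have := htr (2 * j + 1); rwa [localTraceOfEmb_eq_localPairTraceOfEmb] at this
      rw [show 2 * (j + 1) + 1 = 2 * j + 3 by ring, localTraceOfEmb_eq_localPairTraceOfEmb,
        localPairTraceOfEmb_trans ι W (κ.layerSubgroup_antitone (show 2 * i + 2 ≤ 2 * j + 2 by omega))
          (κ.layerSubgroup_antitone (show 2 * j + 2 ≤ 2 * j + 3 by omega)) hd2,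
        htr', map_neg,
        localPairTraceOfEmb_of_mem_mid κ.layerSubgroup ι W κ.layerSubgroup_antitone
          (show 2 * i + 2 ≤ 2 * j + 1 by omega) (show 2 * j + 1 ≤ 2 * j + 2 by omega) (hd (2 * j + 1)),
        ← localTraceOfEmb_eq_localPairTraceOfEmb]
      exact AddSubgroup.neg_mem _ (AddSubgroup.nsmul_mem _ (ih i hlt) _)
    · -- `i = j`: the relation itself
      rw [show 2 * (i + 1) + 1 = 2 * i + 1 + 2 by ring, show 2 * i + 2 = 2 * i + 1 + 1 by ring, htr (2 * i + 1)]
      exact AddSubgroup.neg_mem _ (hd (2 * i + 1))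

/-- **`d_{2j+1} ∈ E⁻(K_{2j+1}·K_v)`** (Kobayashi Prop. 8.12 i), minus half, on the `ℤ_p`-tower). Twin of
`d_even_mem_signedLocalPointsOfEmb_one`. [cite: Kobayashi2003, Prop. 8.12 i) (p. 17)] -/
theorem d_odd_mem_signedLocalPointsOfEmb_neg_one (d : ℕ → localPoints W E)
    (hd : ∀ m, d m ∈ localLayerPointsOfEmb κ ι W m)
    (htr : ∀ m, localTraceOfEmb κ ι W (m + 1) (m + 2) (d (m + 2)) = -d m) (j : ℕ) :
    d (2 * j + 1) ∈ signedLocalPointsOfEmb κ ι W (-1) (2 * j + 1) := by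
  rw [mem_signedLocalPointsOfEmb_neg_one_iff]
  refine ⟨hd (2 * j + 1), fun m hm hodd ↦ ?_⟩
  obtain ⟨i, hi⟩ := hodd
  have him : m = 2 * i + 1 := by omega
  subst him
  rw [show 2 * i + 1 + 1 = 2 * i + 2 by ring]
  exact localTraceOfEmb_d_odd_mem W κ ι d hd htr j i (by omega)

/-! ## §3 CYC⁻ at the odd layers from the Honda system -/

/-- **CYC⁻ at the odd layers from a Honda system** (Kobayashi Prop. 8.12 i) READ on the `ℤ_p`-tower, modulo `p`, minus half): under
(NT), (IDX), (L), (TR), (GEN) and the base clause (CYC₁) `E(K_1·K_v) = ℤ[Γ_{K_v}]·d_1 + p·E(K_1·K_v)`, for every `j` and every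
`x ∈ E⁻(K_{2j+1}·K_v)` there are `B` in the span of the `Γ_{K_v}`-orbit of `d_{2j+1}` and `b ∈ E⁻(K_{2j+1}·K_v)` with `x = B + p • b`.
The induction step is that of `plusCyclic_even_of_honda` with every index shifted by one.
[cite: Kobayashi2003, Prop. 8.12 (pp. 17–18)] -/
theorem minusCyclic_odd_of_honda
    (hnt : ∀ P ∈ localTowerPointsOfEmb κ ι W, p • P = 0 → P = 0)
    (hidx : ∀ m : ℕ, ((localLayerSubgroupOfEmb κ ι (m + 1)).subgroupOf (localLayerSubgroupOfEmb κ ι m)).index = p)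
    (d : ℕ → localPoints W E) (hd : ∀ m, d m ∈ localLayerPointsOfEmb κ ι W m)
    (htr : ∀ m, localTraceOfEmb κ ι W (m + 1) (m + 2) (d (m + 2)) = -d m)
    (hgen : ∀ m : ℕ, 1 ≤ m → ∀ P ∈ localLayerPointsOfEmb κ ι W m,
      ∃ B ∈ AddSubgroup.closure (Set.range fun σ : Field.absoluteGaloisGroup E ↦ σ • d m),
        ∃ P' ∈ localLayerPointsOfEmb κ ι W (m - 1), ∃ R ∈ localLayerPointsOfEmb κ ι W m, P = B + P' + p • R)
    (hcyc1 : ∀ x ∈ localLayerPointsOfEmb κ ι W 1,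
      ∃ B ∈ AddSubgroup.closure (Set.range fun σ : Field.absoluteGaloisGroup E ↦ σ • d 1),
        ∃ b ∈ localLayerPointsOfEmb κ ι W 1, x = B + p • b) :
    ∀ j : ℕ, ∀ x ∈ signedLocalPointsOfEmb κ ι W (-1) (2 * j + 1),
      ∃ B ∈ AddSubgroup.closure (Set.range fun σ : Field.absoluteGaloisGroup E ↦ σ • d (2 * j + 1)),
        ∃ b ∈ signedLocalPointsOfEmb κ ι W (-1) (2 * j + 1), x = B + p • b := by
  intro j
  induction j with
  | zero =>
    intro x hx
    rw [Nat.mul_zero, Nat.zero_add, signedLocalPointsOfEmb_neg_one_one] at hx ⊢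
    exact hcyc1 x hx
  | succ j ih =>
    intro x hx
    -- notation: `n = 2j+3`, the minus group at `n`, saturation and stability facts
    have hn : 2 * (j + 1) + 1 = 2 * j + 3 := by ring
    rw [hn] at hx ⊢
    have hdn : d (2 * j + 3) ∈ signedLocalPointsOfEmb κ ι W (-1) (2 * j + 3) := by
      have := d_odd_mem_signedLocalPointsOfEmb_neg_one W κ ι d hd htr (j + 1); rwa [hn] at this
    have hd2j : d (2 * j + 1) ∈ signedLocalPointsOfEmb κ ι W (-1) (2 * j + 1) :=
      d_odd_mem_signedLocalPointsOfEmb_neg_one W κ ι d hd htr j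
    have hmono : signedLocalPointsOfEmb κ ι W (-1) (2 * j + 1) ≤ signedLocalPointsOfEmb κ ι W (-1) (2 * j + 3) :=
      signedLocalPointsOfEmb_mono κ ι W (-1) (by omega)
    have hAMn : signedLocalPointsOfEmb κ ι W (-1) (2 * j + 3) ≤ localLayerPointsOfEmb κ ι W (2 * j + 3) :=
      signedLocalPointsOfEmb_le κ ι W (-1) _
    have hMnM : localLayerPointsOfEmb κ ι W (2 * j + 3) ≤ localTowerPointsOfEmb κ ι W :=
      localLayerPointsOfEmb_le_localTowerPointsOfEmb κ ι W _
    have hclo_n := closure_orbit_le_signedLocalPointsOfEmb W κ ι (-1) (2 * j + 3) hdn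
    have hclo_2j := closure_orbit_le_signedLocalPointsOfEmb W κ ι (-1) (2 * j + 1) hd2j
    -- `d_{2j+1} = -Tr d_n` lies in the orbit span of `d_n`
    have hd2j_orbit : d (2 * j + 1) ∈ AddSubgroup.closure
        (Set.range fun σ : Field.absoluteGaloisGroup E ↦ σ • d (2 * j + 3)) := by
      have h := localTraceOfEmb_mem_closure_orbit W κ ι (2 * j + 2) (2 * j + 3) (d (2 * j + 3))
      rw [show 2 * j + 3 = 2 * j + 1 + 2 by ring, show 2 * j + 2 = 2 * j + 1 + 1 by ring, htr (2 * j + 1)] at h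
      have := AddSubgroup.neg_mem _ h
      rwa [neg_neg] at this
    have horbit_le := closure_orbit_le_of_mem W (d (2 * j + 3)) hd2j_orbit
    -- the trace on points of the layer `n-1` is multiplication by `p`
    have htrp : ∀ Q ∈ localLayerPointsOfEmb κ ι W (2 * j + 2),
        localTraceOfEmb κ ι W (2 * j + 2) (2 * j + 3) Q = p • Q := fun Q hQ ↦ by
      rw [localTraceOfEmb_apply_of_mem_lower κ ι W (2 * j + 2) (2 * j + 3) hQ, hidx (2 * j + 2)]
    -- (GEN) for `x`
    obtain ⟨B, hB, P', hP', R, hR, hxe⟩ := hgen (2 * j + 3) (by omega) x (hAMn hx)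
    rw [show 2 * j + 3 - 1 = 2 * j + 2 by omega] at hP'
    have hTrR : localTraceOfEmb κ ι W (2 * j + 2) (2 * j + 3) R ∈ localLayerPointsOfEmb κ ι W (2 * j + 2) :=
      localTraceOfEmb_mem_of_mem κ ι W (2 * j + 2) (2 * j + 3) hR
    -- `R' := p R − Tr R ∈ E⁻_n`
    set R' : localPoints W E := p • R - localTraceOfEmb κ ι W (2 * j + 2) (2 * j + 3) R with hR'def
    have hR'top : localTraceOfEmb κ ι W (2 * j + 2) (2 * j + 3) R' = 0 := by
      rw [hR'def, map_sub, map_nsmul, htrp _ hTrR, sub_self]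
    have hR'n : R' ∈ localLayerPointsOfEmb κ ι W (2 * j + 3) :=
      sub_mem (AddSubgroup.nsmul_mem _ hR _) (localLayerPointsOfEmb_mono κ ι W (by omega) hTrR)
    have hR'minus : R' ∈ signedLocalPointsOfEmb κ ι W (-1) (2 * j + 3) := by
      rw [mem_signedLocalPointsOfEmb_neg_one_iff]
      refine ⟨hR'n, fun m hm hodd ↦ ?_⟩
      have hm' : m + 1 ≤ 2 * j + 2 := by obtain ⟨i, hi⟩ := hodd; omega
      have hR'fix : R' ∈ localFixedPointsOfEmb ι W (κ.layerSubgroup (2 * j + 3)) := hR'n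
      have hR'top' : localPairTraceOfEmb ι W (κ.layerSubgroup (2 * j + 2)) (κ.layerSubgroup (2 * j + 3)) R' = 0 := by
        have := hR'top; rwa [localTraceOfEmb_eq_localPairTraceOfEmb] at this
      rw [localTraceOfEmb_eq_localPairTraceOfEmb,
        localPairTraceOfEmb_trans ι W (κ.layerSubgroup_antitone hm')
          (κ.layerSubgroup_antitone (show 2 * j + 2 ≤ 2 * j + 3 by omega)) hR'fix,
        hR'top', map_zero]
      exact AddSubgroup.zero_mem _
    have hpR : p • R = R' + localTraceOfEmb κ ι W (2 * j + 2) (2 * j + 3) R := by rw [hR'def, sub_add_cancel]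
    -- `P'' := P' + Tr R ∈ E⁻_n ∩ M_{n-1} ≤ E⁻_{2j+2} ≤ E⁻_{2j+1}`
    have hP''minus : P' + localTraceOfEmb κ ι W (2 * j + 2) (2 * j + 3) R ∈
        signedLocalPointsOfEmb κ ι W (-1) (2 * j + 1) := by
      have h1 : P' + localTraceOfEmb κ ι W (2 * j + 2) (2 * j + 3) R = x - B - R' := by
        rw [hxe, hpR]; abel
      have h2 : P' + localTraceOfEmb κ ι W (2 * j + 2) (2 * j + 3) R ∈ signedLocalPointsOfEmb κ ι W (-1) (2 * j + 3) := by
        rw [h1]; exact sub_mem (sub_mem hx (hclo_n hB)) hR'minus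
      have h3 : P' + localTraceOfEmb κ ι W (2 * j + 2) (2 * j + 3) R ∈ signedLocalPointsOfEmb κ ι W (-1) (2 * j + 2) :=
        mem_signedLocalPointsOfEmb_of_mem_layer W κ ι hnt (-1) (by omega) h2 (add_mem hP' hTrR)
      exact signedLocalPointsOfEmb_neg_one_even_succ_le W κ ι hnt j h3
    obtain ⟨B₂, hB₂, b₂, hb₂, hP''e⟩ := ih _ hP''minus
    -- `R' ∈ p • E⁻_n + ⟨Γ·d_{2j+1}⟩`: (GEN) for `R`
    obtain ⟨B₃, hB₃, Q, hQ, R₃, hR₃, hRe⟩ := hgen (2 * j + 3) (by omega) R hR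
    rw [show 2 * j + 3 - 1 = 2 * j + 2 by omega] at hQ
    have hTrB₃ : localTraceOfEmb κ ι W (2 * j + 2) (2 * j + 3) B₃ ∈
        AddSubgroup.closure (Set.range fun σ : Field.absoluteGaloisGroup E ↦ σ • d (2 * j + 1)) := by
      have hd3 : d (2 * j + 1 + 2) ∈ localLayerPointsOfEmb κ ι W (2 * j + 1 + 2) := hd _
      have h := localTraceOfEmb_mem_closure_orbit_of_traceRel W κ ι (2 * j + 1) hd3 (htr (2 * j + 1))
        (x := B₃) (by rw [show 2 * j + 1 + 2 = 2 * j + 3 by ring]; exact hB₃)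
      rw [show 2 * j + 1 + 1 = 2 * j + 2 by ring, show 2 * j + 1 + 2 = 2 * j + 3 by ring] at h
      exact h
    set T : localPoints W E := B₃ + p • R₃ - localTraceOfEmb κ ι W (2 * j + 2) (2 * j + 3) R₃ with hTdef
    have hTR' : R' = p • T - localTraceOfEmb κ ι W (2 * j + 2) (2 * j + 3) B₃ := by
      have hTrRe : localTraceOfEmb κ ι W (2 * j + 2) (2 * j + 3) R =
          localTraceOfEmb κ ι W (2 * j + 2) (2 * j + 3) B₃ + p • Q +
            p • localTraceOfEmb κ ι W (2 * j + 2) (2 * j + 3) R₃ := by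
        rw [hRe, map_add, map_add, map_nsmul, htrp Q hQ]
      rw [hR'def, hTrRe, hTdef, hRe, smul_sub, smul_add, smul_add, smul_add]
      abel
    have hTM : T ∈ localTowerPointsOfEmb κ ι W :=
      hMnM (sub_mem (add_mem ((hclo_n.trans hAMn) hB₃) (AddSubgroup.nsmul_mem _ hR₃ _))
        (localLayerPointsOfEmb_mono κ ι W (by omega) (localTraceOfEmb_mem_of_mem κ ι W _ _ hR₃)))
    have hTminus : T ∈ signedLocalPointsOfEmb κ ι W (-1) (2 * j + 3) := by
      refine mem_signedLocalPointsOfEmb_of_nsmul_mem W κ ι hnt (-1) (2 * j + 3) hTM ?_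
      have e : p • T = R' + localTraceOfEmb κ ι W (2 * j + 2) (2 * j + 3) B₃ := by rw [hTR', sub_add_cancel]
      rw [e]; exact add_mem hR'minus (hmono (hclo_2j hTrB₃))
    -- assemble
    refine ⟨B + B₂ - localTraceOfEmb κ ι W (2 * j + 2) (2 * j + 3) B₃, ?_, b₂ + T, add_mem (hmono hb₂) hTminus, ?_⟩
    · exact sub_mem (add_mem hB (horbit_le hB₂)) (horbit_le hTrB₃)
    · calc x = B + (P' + localTraceOfEmb κ ι W (2 * j + 2) (2 * j + 3) R) + R' := by rw [hxe, hpR]; abel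
        _ = B + (B₂ + p • b₂) + (p • T - localTraceOfEmb κ ι W (2 * j + 2) (2 * j + 3) B₃) := by rw [hP''e, hTR']
        _ = B + B₂ - localTraceOfEmb κ ι W (2 * j + 2) (2 * j + 3) B₃ + p • (b₂ + T) := by rw [smul_add]; abel

/-! ## §4 The base clause (CYC₁) from the primal Honda data (Sprung's level-one relation) -/

/-- `E(K_v) = ℤ·c_{−1} + p·E(K_v)` from generation by `c_{−1}` with a multiplier `N` prime to `p` (seat honda-p1's clause):
`E(K_v)/(ℤ·c_{−1} + p·E(K_v))` is killed by `N` and by `p`. [cite: Sprung2012, Thm. 2.2 (p. 1487)] [cite: Kobayashi2003, Prop. 8.12 ii)] -/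
theorem gen_zero_cneg_of_nsmul {N : ℕ} (hN : N.Coprime p) {cneg : localPoints W E}
    (hGEN0 : ∀ P ∈ localLayerPointsOfEmb κ ι W 0, ∃ u : ℤ, ∃ R ∈ localLayerPointsOfEmb κ ι W 0, N • P = u • cneg + p • R) :
    ∀ P ∈ localLayerPointsOfEmb κ ι W 0, ∃ u : ℤ, ∃ R ∈ localLayerPointsOfEmb κ ι W 0, P = u • cneg + p • R := by
  intro P hP
  obtain ⟨u, R, hR, h⟩ := hGEN0 P hP
  have hg := Nat.gcd_eq_gcd_ab N p
  rw [Nat.Coprime.gcd_eq_one hN] at hg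
  set a : ℤ := Nat.gcdA N p
  set b : ℤ := Nat.gcdB N p
  have hab : (N : ℤ) * a + (p : ℤ) * b = 1 := by exact_mod_cast hg.symm
  refine ⟨a * u, a • R + b • P, add_mem (AddSubgroup.zsmul_mem _ hR a) (AddSubgroup.zsmul_mem _ hP b), ?_⟩
  have key : P = a • (N • P) + b • (p • P) := by
    conv_lhs => rw [← one_zsmul P, ← hab]
    rw [add_zsmul, mul_comm (N : ℤ) a, mul_zsmul, natCast_zsmul, mul_comm (p : ℤ) b, mul_zsmul, natCast_zsmul]
  conv_lhs => rw [key, h]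
  module

/-- **(CYC₁) `E(K_1·K_v) = ℤ[Γ_{K_v}]·d_1 + p·E(K_1·K_v)` from the primal Honda data at `a_p = 0`**: generation at `m = 1`
(`E(K_1·K_v) = ℤ[Γ]·d_1 + E(K_v) + p·E(K_1·K_v)`), `E(K_v) = ℤ·c_{−1} + p·E(K_v)`, and Sprung's level-one relation
`Tr_{1/0} d_1 = a_p d_0 − (p−1)c_{−1} = −(p−1)c_{−1}`, which puts `c_{−1} = Tr_{1/0} d_1 + p·c_{−1}` into `ℤ[Γ]·d_1 + p·E(K_1·K_v)`
(the trace is a sum of conjugates). [cite: Sprung2012, Thm. 2.2 (relations (1)(2), p. 1487)] [cite: Kobayashi2003, Prop. 8.12 ii)] -/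
theorem cyc_one_of_gen {cneg : localPoints W E} {d : ℕ → localPoints W E}
    (hcneg : cneg ∈ localLayerPointsOfEmb κ ι W 0)
    (hR1 : localTraceOfEmb κ ι W 0 1 (d 1) = -(((p : ℤ) - 1) • cneg))
    (hgen1 : ∀ P ∈ localLayerPointsOfEmb κ ι W 1,
      ∃ B ∈ AddSubgroup.closure (Set.range fun σ : Field.absoluteGaloisGroup E ↦ σ • d 1),
        ∃ P' ∈ localLayerPointsOfEmb κ ι W 0, ∃ R ∈ localLayerPointsOfEmb κ ι W 1, P = B + P' + p • R)
    (hgen0 : ∀ P ∈ localLayerPointsOfEmb κ ι W 0, ∃ u : ℤ, ∃ R ∈ localLayerPointsOfEmb κ ι W 0, P = u • cneg + p • R) :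
    ∀ x ∈ localLayerPointsOfEmb κ ι W 1,
      ∃ B ∈ AddSubgroup.closure (Set.range fun σ : Field.absoluteGaloisGroup E ↦ σ • d 1),
        ∃ b ∈ localLayerPointsOfEmb κ ι W 1, x = B + p • b := by
  intro x hx
  have h01 : localLayerPointsOfEmb κ ι W 0 ≤ localLayerPointsOfEmb κ ι W 1 := localLayerPointsOfEmb_mono κ ι W (by omega)
  obtain ⟨B, hB, P', hP', R, hR, hxe⟩ := hgen1 x hx
  obtain ⟨u, R₀, hR₀, hP'e⟩ := hgen0 P' hP'
  -- `c_{−1} = Tr_{1/0} d_1 + p • c_{−1}`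
  have hcneg_eq : cneg = localTraceOfEmb κ ι W 0 1 (d 1) + p • cneg := by
    rw [hR1, sub_smul, one_smul, neg_sub, natCast_zsmul, sub_add_cancel]
  have hTr : localTraceOfEmb κ ι W 0 1 (d 1) ∈
      AddSubgroup.closure (Set.range fun σ : Field.absoluteGaloisGroup E ↦ σ • d 1) :=
    localTraceOfEmb_mem_closure_orbit W κ ι 0 1 (d 1)
  refine ⟨B + u • localTraceOfEmb κ ι W 0 1 (d 1), add_mem hB (AddSubgroup.zsmul_mem _ hTr u),
    u • cneg + R₀ + R, add_mem (add_mem (AddSubgroup.zsmul_mem _ (h01 hcneg) u) (h01 hR₀)) hR, ?_⟩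
  rw [hxe, hP'e]
  conv_lhs => rw [hcneg_eq]
  module

end Summit.BirchSwinnertonDyer.BirchSwinnertonDyer.Theorems.SignedEC

end
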